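import Summits.SmoothPoincare4.SmoothPoincare4.Theorems.RootDecompAEDoublesBeyondShadowTwoLedgerTwinsB

/-!
# Grade-four ownership ledger `LocalTableLE4 → GradeFourDichotomy` for KMN encoding graphs, part 3/15: free-group bookkeeping; local certificates of a piece; the small local table

§2 signed words, exponent sums and `H₁ = 0 ⟹` unimodular exponent matrix; §3 the decidable LOCAL CERTIFICATE format
`LStep` / `lcheck` / `LocalCert` of a piece (five letters), the local exponent matrix `pmat` and minor `minor :=
Block.det (pmat p J)`, the hypotheses `TableHyp` of the local table, and the decide-checked local table of the six
pieces without true vertices (`localTable_small`).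

THE FAMILY (14 modules `Theorems/RootDecompAEDoublesBeyondShadowTwoLedger*.lean` + the closing module
`Theorems/RootDecompAEDoublesBeyondShadowTwoStubLedgerFour.lean`, one namespace
`Summit.SmoothPoincare4.SmoothPoincare4.Theorems.RootDecompAEDoublesBeyondShadowTwoStubLedgerFour`, linearly chained
imports, split by topic to respect the 400-line bound on proof files).
-/

open Function
open Literature.Topology.FourManifolds

set_option linter.dupNamespace false

noncomputable section

namespace Summit.SmoothPoincare4.SmoothPoincare4.Theorems.RootDecompAEDoublesBeyondShadowTwoStubLedgerFour

/-! ## §2 Free-group bookkeeping: signed words, exponent sums, and `H₁ = 0 ⟹ unimodular exponent matrix` -/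

section FreeGroupLemmas

variable {ι : Type} [DecidableEq ι]

/-- A word or its inverse, selected by a Boolean sign. -/
def sgnw {α : Type} (t : Bool) (w : FreeGroup α) : FreeGroup α := if t then w⁻¹ else w

/-- `sgnw` in a free group, as an `if`. -/
theorem sgnw_eq_ite {α : Type} (t : Bool) (w : FreeGroup α) : sgnw t w = if t then w⁻¹ else w := rfl

/-- Double sign: `sgnw t (sgnw t' w) = sgnw (t xor t') w`. -/
theorem sgnw_sgnw {α : Type} (t t' : Bool) (w : FreeGroup α) : sgnw t (sgnw t' w) = sgnw (xor t t') w := by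
  cases t <;> cases t' <;> simp [sgnw]

/-- The exponent-sum character of the generator `j` (multiplicative notation). -/
def gexp (j : ι) : FreeGroup ι →* Multiplicative ℤ :=
  FreeGroup.lift fun i => if i = j then Multiplicative.ofAdd 1 else 1

/-- The exponent sum of the generator `j` in the word `w`. -/
def expo (j : ι) (w : FreeGroup ι) : ℤ := Multiplicative.toAdd (gexp j w)

/-- Exponent sum of a letter in a one-letter word. -/
@[simp] theorem expo_of (i j : ι) : expo j (FreeGroup.of i) = if i = j then 1 else 0 := by
  unfold expo gexp
  rw [FreeGroup.lift_apply_of]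
  split_ifs <;> rfl

/-- Exponent sums are additive. -/
@[simp] theorem expo_mul (j : ι) (v w : FreeGroup ι) : expo j (v * w) = expo j v + expo j w := by
  unfold expo; rw [map_mul, toAdd_mul]

/-- Exponent sums change sign under inversion. -/
@[simp] theorem expo_inv (j : ι) (w : FreeGroup ι) : expo j w⁻¹ = -expo j w := by
  unfold expo; rw [map_inv, toAdd_inv]

/-- The empty word has all exponent sums zero. -/
@[simp] theorem expo_one (j : ι) : expo j (1 : FreeGroup ι) = 0 := by
  unfold expo; rw [map_one, toAdd_one]

/-- Exponent sums are conjugation invariant. -/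
theorem expo_conj (j : ι) (g w : FreeGroup ι) : expo j (g * w * g⁻¹) = expo j w := by
  simp only [expo_mul, expo_inv]; ring

/-- Exponent sums along a renaming of the generators by an equivalence. -/
theorem expo_map_equiv {κ : Type} [DecidableEq κ] (e : ι ≃ κ) (j : κ) (w : FreeGroup ι) :
    expo j (FreeGroup.map e w) = expo (e.symm j) w := by
  have h : (gexp j).comp (FreeGroup.map e) = gexp (e.symm j) := by
    refine FreeGroup.ext_hom _ _ fun i => ?_
    simp only [MonoidHom.coe_comp, Function.comp_apply, FreeGroup.map.of, gexp, FreeGroup.lift_apply_of]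
    by_cases hij : e i = j
    · have : i = e.symm j := by rw [← hij]; simp
      simp [this]
    · have : i ≠ e.symm j := by rintro rfl; simp at hij
      simp [hij, this]
  unfold expo
  exact congrArg Multiplicative.toAdd (DFunLike.congr_fun h w)

/-- THE EXPONENT MATRIX of a family of words `R : ι → FreeGroup ι`: entry `(r, j)` is the exponent sum of the
generator `j` in the word `R r`. -/
def expoMat [Fintype ι] (R : ι → FreeGroup ι) : Matrix ι ι ℤ := Matrix.of fun r j => expo j (R r)

/-- The words whose exponent vector is an integer combination of the exponent vectors of the `R r` form a
NORMAL subgroup (it is the preimage of a subgroup of the abelianisation). -/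
def combSubgroup [Fintype ι] (R : ι → FreeGroup ι) : Subgroup (FreeGroup ι) where
  carrier := {w | ∃ c : ι → ℤ, ∀ j, expo j w = ∑ r, c r * expo j (R r)}
  one_mem' := ⟨0, fun j => by simp⟩
  mul_mem' := by
    rintro v w ⟨c, hc⟩ ⟨d, hd⟩
    refine ⟨c + d, fun j => ?_⟩
    simp only [expo_mul, hc, hd, Pi.add_apply, add_mul, Finset.sum_add_distrib]
  inv_mem' := by
    rintro w ⟨c, hc⟩
    refine ⟨-c, fun j => ?_⟩
    simp only [expo_inv, hc, Pi.neg_apply, neg_mul, Finset.sum_neg_distrib]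

/-- The kernel of all exponent sums that vanish on the relators is a normal subgroup. -/
theorem combSubgroup_normal [Fintype ι] (R : ι → FreeGroup ι) : (combSubgroup R).Normal := by
  refine ⟨fun w hw g => ?_⟩
  obtain ⟨c, hc⟩ := hw
  refine ⟨c, fun j => ?_⟩
  rw [expo_conj]
  exact hc j

/-- **`H₁ = 0 ⟹ unimodular`.**  If the words `R r` normally generate the free group (the presentation
`⟨ι ∣ R⟩` is the trivial group), then the exponent matrix is invertible over `ℤ`: its determinant is a unit. -/
theorem isUnit_det_expoMat [Fintype ι] (R : ι → FreeGroup ι)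
    (h : Subgroup.normalClosure (Set.range R) = ⊤) : IsUnit (expoMat R).det := by
  classical
  haveI := combSubgroup_normal R
  have hle : Subgroup.normalClosure (Set.range R) ≤ combSubgroup R := by
    refine Subgroup.normalClosure_le_normal ?_
    rintro _ ⟨r, rfl⟩
    refine ⟨fun r' => if r' = r then 1 else 0, fun j => ?_⟩
    simp [Finset.sum_ite_eq']
  have hmem : ∀ j : ι, ∃ c : ι → ℤ, ∀ j', expo j' (FreeGroup.of j) = ∑ r, c r * expo j' (R r) := by
    intro j
    have : FreeGroup.of j ∈ combSubgroup R := hle (by rw [h]; exact Subgroup.mem_top _)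
    exact this
  choose c hc using hmem
  let C : Matrix ι ι ℤ := Matrix.of fun j r => c j r
  have hCM : C * expoMat R = 1 := by
    ext j j'
    rw [Matrix.mul_apply, Matrix.one_apply]
    have := hc j j'
    rw [expo_of] at this
    simp only [C, expoMat, Matrix.of_apply]
    rw [← this]
  have hdet : C.det * (expoMat R).det = 1 := by rw [← Matrix.det_mul, hCM, Matrix.det_one]
  have hdet' : (expoMat R).det * C.det = 1 := by rw [mul_comm]; exact hdet
  exact ⟨⟨(expoMat R).det, C.det, hdet', hdet⟩, rfl⟩

end FreeGroupLemmas

/-! ## §3 Local elimination certificates of a piece (decidable data) and the local minors -/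

section LocalCert

/-- One LOCAL elimination step at a piece: the port whose (substituted, signed) word is used, the letter eliminated, the
complementary word `W` (so that the word is conjugate to `(x · W)^{±1}`), the sign, and an explicit conjugator. -/
structure LStep where
  /-- port index of the piece -/
  port : ℕ
  /-- the letter eliminated at this step -/
  letter : Fin 5
  /-- the word `W` with `(substituted port word)^{±1} ~ letter · W` -/
  word : FreeGroup (Fin 5)
  /-- `true`: the port word is inverted before comparing -/
  sgn : Bool
  /-- an explicit conjugator exhibiting the conjugacy -/
  conj : FreeGroup (Fin 5)

/-- The substitution of `F₅` killing the letters of a list and fixing the others. -/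
def lkill (L : List (Fin 5)) : FreeGroup (Fin 5) →* FreeGroup (Fin 5) :=
  FreeGroup.lift fun y => if y ∈ L then 1 else FreeGroup.of y

/-- THE LOCAL CHECK of a step list against the port words of the piece `p`, from a local state: the values `Λ` of the
accumulated substitution on the five letters and the list `El` of letters eliminated so far.  Per step: the letter is
fresh; the word is fixed by killing `El` and the letter (so it is a word in the other fresh letters); the explicit
conjugate of the signed, substituted port word IS `x · W`; then `x ↦ W⁻¹` is composed into `Λ`.  At the end all five
letters are eliminated and the accumulated substitution kills every letter. -/
def lcheck (p : Piece) : List LStep → (Fin 5 → FreeGroup (Fin 5)) → List (Fin 5) → Bool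
  | [], Λ, El => (List.finRange 5).all fun i => decide (i ∈ El) && decide (Λ i = 1)
  | s :: rest, Λ, El =>
      !decide (s.letter ∈ El) && decide (lkill (s.letter :: El) s.word = s.word) &&
        decide (s.conj * sgnw s.sgn (FreeGroup.lift Λ (p.portWord s.port)) * s.conj⁻¹ =
            FreeGroup.of s.letter * s.word) &&
          lcheck p rest (fun y => Roe.substHom s.letter s.word (Λ y)) (s.letter :: El)

/-- The INITIAL local substitution of a piece: the unused letters (index `≥ rank`) are killed. -/
def linit (p : Piece) : Fin 5 → FreeGroup (Fin 5) := fun j => if p.rank ≤ (j : ℕ) then 1 else FreeGroup.of j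

/-- The INITIAL eliminated letters of a piece: its unused letters. -/
def lunused (p : Piece) : List (Fin 5) := (List.finRange 5).filter fun j => p.rank ≤ (j : ℕ)

/-- A LOCAL CERTIFICATE of the piece `p` for the list of ports `J`: a step list passing the local check from the initial
state whose ports are exactly `J` up to order. -/
def LocalCert (p : Piece) (J : List ℕ) : Prop :=
  ∃ steps : List LStep, lcheck p steps (linit p) (lunused p) = true ∧ (steps.map LStep.port).Perm J

/-- Exponent sum of the letter `l` in the `j`-th port word of `p`. -/
def pexp (p : Piece) (j : ℕ) (l : Fin 5) : ℤ := expo l (p.portWord j)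

/-- Exponent sum of the letter with index `b` (junk `0` for `b ≥ 5`). -/
def pexpN (p : Piece) (j b : ℕ) : ℤ := if h : b < 5 then pexp p j ⟨b, h⟩ else 0

/-- THE LOCAL EXPONENT MATRIX of a port list `J`: one row per listed port, columns the first `|J|` letters. -/
def pmat (p : Piece) (J : List ℕ) : List (List ℤ) := J.map fun j => (List.range J.length).map (pexpN p j)

/-- THE LOCAL MINOR of a port list: the determinant of its local exponent matrix (the block calculus' Laplace determinant). -/
def minor (p : Piece) (J : List ℕ) : ℤ := Block.det (pmat p J)

/-- THE HYPOTHESES OF THE LOCAL TABLE for the port list `J` of the piece `p`: `J` lists `rank p` ports, strictly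
increasing, all existing, and the local minor is `±1`. -/
def TableHyp (p : Piece) (J : List ℕ) : Prop :=
  J.length = p.rank ∧ J.Pairwise (· < ·) ∧ (∀ j ∈ J, j < p.numPorts) ∧ (minor p J = 1 ∨ minor p J = -1)

/-- Rank zero: the port list is empty. -/
theorem tableHyp_zero {p : Piece} (hp : p.rank = 0) {J : List ℕ} (h : TableHyp p J) : J = [] := by
  obtain ⟨hl, -, -, -⟩ := h
  rw [hp] at hl
  exact List.eq_nil_of_length_eq_zero hl

/-- Rank one: one existing port with unit local minor. -/
theorem tableHyp_one {p : Piece} (hp : p.rank = 1) {J : List ℕ} (h : TableHyp p J) :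
    ∃ j₀, J = [j₀] ∧ j₀ < p.numPorts ∧ (minor p [j₀] = 1 ∨ minor p [j₀] = -1) := by
  obtain ⟨hl, -, hlt, hu⟩ := h
  rw [hp] at hl
  match J, hl, hlt, hu with
  | [j₀], _, hlt, hu => exact ⟨j₀, rfl, hlt j₀ (by simp), hu⟩

/-- Rank two: two existing ports `j₀ < j₁` with unimodular `2 × 2` exponent block. -/
theorem tableHyp_two {p : Piece} (hp : p.rank = 2) {J : List ℕ} (h : TableHyp p J) :
    ∃ j₀ j₁, J = [j₀, j₁] ∧ j₀ < j₁ ∧ j₁ < p.numPorts ∧ (minor p [j₀, j₁] = 1 ∨ minor p [j₀, j₁] = -1) := by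
  obtain ⟨hl, hs, hlt, hu⟩ := h
  rw [hp] at hl
  match J, hl, hs, hlt, hu with
  | [j₀, j₁], _, hs, hlt, hu =>
    rw [List.pairwise_cons] at hs
    exact ⟨j₀, j₁, rfl, hs.1 j₁ (by simp), hlt j₁ (by simp), hu⟩

/-- Every piece has rank at most five. -/
theorem rank_le_five (p : Piece) : p.rank ≤ 5 := by
  cases p with
  | block s _ => show s.V + 1 ≤ 5; cases s <;> decide
  | _ => decide

end LocalCert

/-! ### The small local table: the six pieces without true vertices (decide-checked) -/

section SmallTable

open Piece

/-- `disc` (rank 0): the empty certificate. -/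
theorem localTable_disc : LocalCert disc [] := ⟨[], by decide, List.Perm.refl _⟩

/-- `pants`, ports `0, 1` (`a`, `b`). -/
theorem localTable_pants_01 : LocalCert pants [0, 1] :=
  ⟨[⟨0, 0, 1, false, 1⟩, ⟨1, 1, 1, false, 1⟩], by decide, List.Perm.refl _⟩

/-- `pants`, ports `0, 2` (`a`, `ab`): eliminate `b` from `ab` (`W = 1` after `a ↦ 1`)?  No: eliminate `a` by port 0, then `b` by port 2. -/
theorem localTable_pants_02 : LocalCert pants [0, 2] :=
  ⟨[⟨0, 0, 1, false, 1⟩, ⟨2, 1, 1, false, 1⟩], by decide, List.Perm.refl _⟩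

/-- `pants`, ports `1, 2` (`b`, `ab`). -/
theorem localTable_pants_12 : LocalCert pants [1, 2] :=
  ⟨[⟨1, 1, 1, false, 1⟩, ⟨2, 0, 1, false, 1⟩], by decide, List.Perm.refl _⟩

/-- `y111`, any one port (`a`). -/
theorem localTable_y111 (j : ℕ) (hj : j < 3) : LocalCert y111 [j] := by
  refine ⟨[⟨j, 0, 1, false, 1⟩], ?_, List.Perm.refl _⟩
  interval_cases j <;> decide

/-- `y12`, port `0` (`a`). -/
theorem localTable_y12_0 : LocalCert y12 [0] := ⟨[⟨0, 0, 1, false, 1⟩], by decide, List.Perm.refl _⟩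

/-- The excluded minors of the small pieces: `moebius` port 0 (`a²`), `y12` port 1 (`a²`), `y3` port 0 (`a³`). -/
theorem smallMinors : minor moebius [0] = 2 ∧ minor y12 [1] = 2 ∧ minor y3 [0] = 3 := by decide

/-- THE SMALL LOCAL TABLE: for the six pieces without true vertices, the table hypotheses give a local certificate. -/
theorem localTable_small (p : Piece) (hp : p.numTrueVertices = 0) {J : List ℕ} (h : TableHyp p J) : LocalCert p J := by
  cases p with
  | disc => rw [tableHyp_zero rfl h]; exact localTable_disc
  | pants =>
    obtain ⟨j₀, j₁, rfl, h01, h1, -⟩ := tableHyp_two rfl h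
    have h1' : j₁ < 3 := h1
    interval_cases j₁ <;> interval_cases j₀
    · exact localTable_pants_01
    · exact localTable_pants_02
    · exact localTable_pants_12
  | moebius =>
    obtain ⟨j₀, rfl, h0, hu⟩ := tableHyp_one rfl h
    have h0' : j₀ < 1 := h0
    interval_cases j₀
    rw [smallMinors.1] at hu; omega
  | y111 =>
    obtain ⟨j₀, rfl, h0, -⟩ := tableHyp_one rfl h
    exact localTable_y111 j₀ h0
  | y12 =>
    obtain ⟨j₀, rfl, h0, hu⟩ := tableHyp_one rfl h
    have h0' : j₀ < 2 := h0
    interval_cases j₀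
    · exact localTable_y12_0
    · rw [smallMinors.2.1] at hu; omega
  | y3 =>
    obtain ⟨j₀, rfl, h0, hu⟩ := tableHyp_one rfl h
    have h0' : j₀ < 1 := h0
    interval_cases j₀
    rw [smallMinors.2.2] at hu; omega
  | block s c => simp [numTrueVertices] at hp; cases s <;> simp [BlockShape.V] at hp

end SmallTable

end Summit.SmoothPoincare4.SmoothPoincare4.Theorems.RootDecompAEDoublesBeyondShadowTwoStubLedgerFour
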